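import Mathlib
import Summits.Ventures.PercRepro2.Defs
import Summits.Ventures.PercRepro2.Graph
import Summits.Ventures.PercRepro2.OneColourSwitch
import Summits.Ventures.PercRepro2.M9LinkedHD

/-!
# A neighbourhood condition for the linked hypothesis of class C7 (blind cell PercRepro2,
p3 g29, 2026-08-28; `proofs/P3-LINKED.md` §1)

`Linked ends r s d` (`M9LinkedHD`) asks that every `r–s` connection avoiding `d` pass through a
neighbour of `d`.  It holds as soon as there is no `r–s` edge and every neighbour of `r` other
than `s` and `d` is a neighbour of `d` (`linked_of_nbhd_r`): the first internal vertex of an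
open `r–s` path is then adjacent to `d`.  The mirror condition at `s` gives the same by
symmetry of the graph; the two together cover the graphs `r–v₁–…–v_k–s` with `d` adjacent to
every `v_i` and an arbitrary pocket on `d, p, q`, which lie in no earlier class.  Own work; std
axioms.
-/

namespace Summit.Ventures.PercRepro2

namespace NoPocket

open Finset Classical RegionHub OneColourSwitch SideSwitch TermSwitch

variable {V : Type*} {E : Type*}

section Nbhd

variable {ends : E → Sym2 V} {r s d : V}

/-- **A sufficient condition for the linked hypothesis**: no `r–s` edge, and every neighbour of
`r` other than `s` and `d` is a neighbour of `d` (the first internal vertex of an `r–s` path is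
adjacent to `d`). -/
theorem linked_of_nbhd_r (hrs : r ≠ s) (hno : ∀ e, ends e ≠ s(r, s))
    (hN : ∀ e x, ends e = s(r, x) → x ≠ r → x ≠ s → x ≠ d → ∃ e', ends e' = s(d, x)) :
    Linked ends r s d := by
  intro ω hconn hrd
  rw [Conn, SimpleGraph.reachable_iff_reflTransGen] at hconn
  rcases Relation.ReflTransGen.cases_head hconn with h | ⟨x, hadj, _⟩
  · exact absurd h hrs
  · obtain ⟨hne, e, he, hends⟩ := openGraph_adj.1 hadj
    have hrx : Conn ends ω r x := conn_of_openAdj ⟨e, he, hends⟩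
    have hxs : x ≠ s := fun hxs => hno e (by rw [hends, hxs])
    have hxd : x ≠ d := fun hxd => hrd (by rw [← hxd]; exact hrx)
    obtain ⟨e', he'⟩ := hN e x hends (Ne.symm hne) hxs hxd
    exact ⟨x, e', he', Ne.symm hne, hxs, hxd, hrx⟩

/-- **The mirror condition at `s`**: no `r–s` edge, and every neighbour of `s` other than `r` and
`d` is a neighbour of `d`. -/
theorem linked_of_nbhd_s (hrs : r ≠ s) (hno : ∀ e, ends e ≠ s(r, s))
    (hN : ∀ e x, ends e = s(s, x) → x ≠ r → x ≠ s → x ≠ d → ∃ e', ends e' = s(d, x)) :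
    Linked ends r s d := by
  intro ω hconn hrd
  have hconn' : Conn ends ω s r := conn_symm hconn
  rw [Conn, SimpleGraph.reachable_iff_reflTransGen] at hconn'
  rcases Relation.ReflTransGen.cases_head hconn' with h | ⟨x, hadj, _⟩
  · exact absurd h.symm hrs
  · obtain ⟨hne, e, he, hends⟩ := openGraph_adj.1 hadj
    have hsx : Conn ends ω s x := conn_of_openAdj ⟨e, he, hends⟩
    have hrx : Conn ends ω r x := conn_trans hconn hsx
    have hxr : x ≠ r := fun hxr => hno e (by rw [hends, hxr, Sym2.eq_swap])
    have hxd : x ≠ d := fun hxd => hrd (by rw [← hxd]; exact hrx)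
    obtain ⟨e', he'⟩ := hN e x hends hxr (Ne.symm hne) hxd
    exact ⟨x, e', he', hxr, Ne.symm hne, hxd, hrx⟩

end Nbhd

end NoPocket

end Summit.Ventures.PercRepro2
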